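import Summits.CriticalPhenomena.PercolationContinuityZ3.Theorems.PercNearOneGluingNoHeavyLowerTailKnQuestion8CoefficientwiseCoreClassKernelMixBundleClassCount
import Summits.CriticalPhenomena.PercolationContinuityZ3.Theorems.PercNearOneGluingNoHeavyLowerTailKnQuestion8CoefficientwiseCoreClassKernelMixBundleBoundary
import Summits.CriticalPhenomena.PercolationContinuityZ3.Theorems.PercNearOneGluingNoHeavyLowerTailKnQuestion8CoefficientwiseCoreClassKernelMixIETLayerCake
import HarnessLib

/-!
# Boundary inequality on bundles, XVIII: THEOREM CT — the clean-thread theorem (three threads, every up-set, all levels)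

Support file (`--supports stmt-CriticalPhenomena-4575`, closed), prover `prim-cplus-coupling` (gen 59).  No definitions, no notations, no named facts,
no sorries; standard axioms.  Memo `prim-cplus-coupling/A5-COUPLING-gen59.md` §1.

On an explicit bundle whose threads are exactly `z, p, q` (pairwise distinct), for EVERY up-closed event `𝒱` and a fixed thread `z`:
* `Coefficientwise.bundle_clean_thread_count` (THEOREM CT-COUNT, all 0/1 levels, NO hypothesis on the sources): the sources of `𝒱` (both types) that are
  NOT blue-starting on `z` (i.e. `e z 1` red, or `z` all blue) are at most the `(L₁ ∪ L₂)`-supply points of `𝒱` starting red on `z` plus the `P₁` demand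
  points of `𝒱` with `z` blue:  `#bad(𝒱 ∖ B_z) ≤ #(L₁ ∪ L₂)(𝒱 ∩ {e z 1 red}) + #P₁(𝒱 ∩ {z blue})`.
  PROOF: the `z`-blue sources are THEOREM BI (`bundle_boundary_count`, landings `z`-full); a source starting red on `z` lies in exactly one red-prefix class
  `R_a(z)`, and every class pays for its own sources inside the class (`bundle_class_count`); the classes, the `z`-full landings and the `P₁` points are
  pairwise disjoint.
* `Coefficientwise.iet_clean_thread_bundle` (ALL monotone real levels `0 ≤ hᵃ, hᵇ ≤ h`, `0 ≤ kᵃ, kᵇ ≤ k`): the increasing-event-transfer functional with its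
  DEMAND restricted to the colourings of `𝒱` that are not blue-starting on `z` (full supply) is nonnegative — in particular CONJECTURE IET holds for every
  `𝒱` none of whose sources is blue-starting on `z` (a CLEAN thread), uniformly in the three lengths; this contains THEOREM BI (all sources `z`-blue) and
  THEOREM RS (all sources red-starting on their non-blue threads).  Layer cake: `iet_of_indicator_levels` + `iet01_ge_count`.
[cite: KozmaNitzan2024, Questions 8–9 (§5.5 p. 36) (context); Harris 1960]
-/

namespace Summit.CriticalPhenomena.PercolationContinuityZ3.Theorems

open Finset Literature.Probability.Percolation

namespace Coefficientwise

variable {ι V : Type*}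

open Classical in
/-- **THEOREM CT-COUNT (clean-thread count; three threads, all 0/1 levels, every up-set).**  Module docstring.  Memo gen 59 §1.
[cite: KozmaNitzan2024, Questions 8–9 (§5.5 p. 36) (context); Harris 1960] -/
theorem bundle_clean_thread_count (ends : ι → Sym2 V) (r : ℕ) (L : ℕ → ℕ) (hL : ∀ t, t < r → 1 ≤ L t)
    (w : ℕ → ℕ → V) (e : ℕ → ℕ → ι) (u b : V)
    (hw0 : ∀ t, t < r → w t 0 = u) (hwL : ∀ t, t < r → w t (L t) = b)
    (harc : ∀ t, t < r → ∀ j, 1 ≤ j → j ≤ L t → ends (e t j) = s(w t (j - 1), w t j))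
    (hwinj : ∀ t, t < r → ∀ i j, i ≤ L t → j ≤ L t → w t i = w t j → i = j)
    (hcross : ∀ t t', t < r → t' < r → t ≠ t' → ∀ i j, i ≤ L t → j ≤ L t' → w t i = w t' j → (i = 0 ∧ j = 0) ∨ (i = L t ∧ j = L t'))
    (A : ℕ → Finset ι) (hA : ∀ t, t < r → ∀ i, i ∈ A t ↔ ∃ j, 1 ≤ j ∧ j ≤ L t ∧ e t j = i)
    (hAdisj : ∀ t t', t < r → t' < r → t ≠ t' → Disjoint (A t) (A t'))
    (E : Finset ι) (hEA : ∀ i, i ∈ E ↔ ∃ t, t < r ∧ i ∈ A t)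
    (z p q : ℕ) (hz : z < r) (hp : p < r) (hq : q < r) (hzp : z ≠ p) (hzq : z ≠ q) (hpq : p ≠ q)
    (hr3 : ∀ t, t < r → t = z ∨ t = p ∨ t = q)
    (𝒱 : Finset ι → Prop) (hV : ∀ ⦃s t : Finset ι⦄, s ⊆ t → 𝒱 s → 𝒱 t)
    (ha hb ka kb : Set V → ℝ) (mha : Monotone ha) (mhb : Monotone hb) (mka : Monotone ka) (mkb : Monotone kb)
    (ha01 : ∀ S, ha S = 0 ∨ ha S = 1) (hb01 : ∀ S, hb S = 0 ∨ hb S = 1) (ka01 : ∀ S, ka S = 0 ∨ ka S = 1) (kb01 : ∀ S, kb S = 0 ∨ kb S = 1) :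
    ((E.powerset).filter (fun σ => (e z 1 ∈ σ ∨ Disjoint (A z) σ) ∧ 𝒱 σ ∧
        (b ∈ openCluster (ends '' (↑(E \ σ) : Set ι)) u ∧ b ∉ openCluster (ends '' (↑σ : Set ι)) u) ∧
        (ha (openCluster (ends '' (↑σ : Set ι)) u) = 1 ∧ hb (openCluster (ends '' (↑(E \ σ) : Set ι)) u) = 0) ∧
        (kb (openCluster (ends '' (↑(E \ σ) : Set ι)) u) = 1 ∧ ka (openCluster (ends '' (↑σ : Set ι)) u) = 0))).card
    + ((E.powerset).filter (fun σ => (e z 1 ∈ σ ∨ Disjoint (A z) σ) ∧ 𝒱 σ ∧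
        (b ∈ openCluster (ends '' (↑(E \ σ) : Set ι)) u ∧ b ∉ openCluster (ends '' (↑σ : Set ι)) u) ∧
        (ka (openCluster (ends '' (↑σ : Set ι)) u) = 1 ∧ kb (openCluster (ends '' (↑(E \ σ) : Set ι)) u) = 0) ∧
        (hb (openCluster (ends '' (↑(E \ σ) : Set ι)) u) = 1 ∧ ha (openCluster (ends '' (↑σ : Set ι)) u) = 0))).card
    ≤ ((E.powerset).filter (fun lam => e z 1 ∈ lam ∧ 𝒱 lam ∧
        (b ∈ openCluster (ends '' (↑lam : Set ι)) u ∧ b ∉ openCluster (ends '' (↑(E \ lam) : Set ι)) u) ∧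
        ((ha (openCluster (ends '' (↑lam : Set ι)) u) = 1 ∧ kb (openCluster (ends '' (↑lam : Set ι)) u) = 1 ∧
            hb (openCluster (ends '' (↑(E \ lam) : Set ι)) u) = 0 ∧ ka (openCluster (ends '' (↑(E \ lam) : Set ι)) u) = 0) ∨
          (ka (openCluster (ends '' (↑lam : Set ι)) u) = 1 ∧ hb (openCluster (ends '' (↑lam : Set ι)) u) = 1 ∧
            kb (openCluster (ends '' (↑(E \ lam) : Set ι)) u) = 0 ∧ ha (openCluster (ends '' (↑(E \ lam) : Set ι)) u) = 0)))).card
      + ((E.powerset).filter (fun σ => Disjoint (A z) σ ∧ 𝒱 σ ∧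
        (b ∈ openCluster (ends '' (↑(E \ σ) : Set ι)) u ∧ b ∉ openCluster (ends '' (↑σ : Set ι)) u) ∧
        (ha (openCluster (ends '' (↑σ : Set ι)) u) = 1 ∧ ka (openCluster (ends '' (↑σ : Set ι)) u) = 1 ∧
          hb (openCluster (ends '' (↑(E \ σ) : Set ι)) u) = 0 ∧ kb (openCluster (ends '' (↑(E \ σ) : Set ι)) u) = 0))).card := by
  set C : Finset ι → Set V := fun ω => openCluster (ends '' (↑ω : Set ι)) u with hC
  have hr : 0 < r := lt_of_le_of_lt (Nat.zero_le z) hz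
  have hAE : ∀ t, t < r → A t ⊆ E := fun t ht i hi => (hEA i).mpr ⟨t, ht, hi⟩
  have heA : ∀ t, t < r → ∀ j, 1 ≤ j → j ≤ L t → e t j ∈ A t := fun t ht j hj1 hjL => (hA t ht _).mpr ⟨j, hj1, hjL, rfl⟩
  have full_iff : ∀ ω : Finset ι, ω ⊆ E → (b ∈ C ω ↔ ∃ t, t < r ∧ A t ⊆ ω) := fun ω hω =>
    bundle_b_mem_cluster_iff_threads ends r L hL w e u b hr hw0 hwL harc hwinj hcross A hA E hEA ω hω
  have hz1 : e z 1 ∈ A z := heA z hz 1 (le_refl 1) (hL z hz)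
  -- ## (1) splitting the sources: red-starting on z / z blue
  have f1 : ((E.powerset).filter (fun σ => (e z 1 ∈ σ ∨ Disjoint (A z) σ) ∧ 𝒱 σ ∧ (b ∈ C (E \ σ) ∧ b ∉ C σ) ∧ (ha (C σ) = 1 ∧ hb (C (E \ σ)) = 0)
        ∧ (kb (C (E \ σ)) = 1 ∧ ka (C σ) = 0))).card =
      ((E.powerset).filter (fun σ => e z 1 ∈ σ ∧ 𝒱 σ ∧ (b ∈ C (E \ σ) ∧ b ∉ C σ) ∧ (ha (C σ) = 1 ∧ hb (C (E \ σ)) = 0) ∧ (kb (C (E \ σ)) = 1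
            ∧ ka (C σ) = 0))).card + ((E.powerset).filter (fun σ => Disjoint (A z) σ ∧ 𝒱 σ ∧ (b ∈ C (E \ σ) ∧ b ∉ C σ) ∧ (ha (C σ) = 1 ∧ hb (C (E \ σ)) = 0)
            ∧ (kb (C (E \ σ)) = 1 ∧ ka (C σ) = 0))).card := by
    rw [← Finset.card_union_of_disjoint]
    · congr 1
      ext σ
      simp only [Finset.mem_filter, Finset.mem_union]
      tauto
    · rw [Finset.disjoint_filter]
      intro σ _ h1 h2
      exact Finset.disjoint_left.mp h2.1 hz1 h1.1
  have f2 : ((E.powerset).filter (fun σ => (e z 1 ∈ σ ∨ Disjoint (A z) σ) ∧ 𝒱 σ ∧ (b ∈ C (E \ σ) ∧ b ∉ C σ) ∧ (ka (C σ) = 1 ∧ kb (C (E \ σ)) = 0)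
        ∧ (hb (C (E \ σ)) = 1 ∧ ha (C σ) = 0))).card =
      ((E.powerset).filter (fun σ => e z 1 ∈ σ ∧ 𝒱 σ ∧ (b ∈ C (E \ σ) ∧ b ∉ C σ) ∧ (ka (C σ) = 1 ∧ kb (C (E \ σ)) = 0) ∧ (hb (C (E \ σ)) = 1
            ∧ ha (C σ) = 0))).card + ((E.powerset).filter (fun σ => Disjoint (A z) σ ∧ 𝒱 σ ∧ (b ∈ C (E \ σ) ∧ b ∉ C σ) ∧ (ka (C σ) = 1 ∧ kb (C (E \ σ)) = 0)
            ∧ (hb (C (E \ σ)) = 1 ∧ ha (C σ) = 0))).card := by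
    rw [← Finset.card_union_of_disjoint]
    · congr 1
      ext σ
      simp only [Finset.mem_filter, Finset.mem_union]
      tauto
    · rw [Finset.disjoint_filter]
      intro σ _ h1 h2
      exact Finset.disjoint_left.mp h2.1 hz1 h1.1
  -- ## (2) the z-blue sources: THEOREM BI
  have hBI := bundle_boundary_count ends r L hL w e u b hw0 hwL harc hwinj hcross A hA hAdisj E hEA p q hp hq hpq z hz hzp hzq 𝒱 hV
    ha hb ka kb mha mhb mka mkb ha01 hb01 ka01 kb01
  have hPQ : ∀ σ : Finset ι, σ ⊆ A p ∪ A q ↔ σ ⊆ E ∧ Disjoint (A z) σ := by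
    intro σ; constructor
    · intro hσ; refine ⟨fun x hx => ?_, Finset.disjoint_left.mpr fun x hxz hxσ => ?_⟩
      · rcases Finset.mem_union.mp (hσ hx) with h | h
        · exact hAE p hp h
        · exact hAE q hq h
      · rcases Finset.mem_union.mp (hσ hxσ) with h | h
        · exact Finset.disjoint_left.mp (hAdisj z p hz hp hzp) hxz h
        · exact Finset.disjoint_left.mp (hAdisj z q hz hq hzq) hxz h
    · rintro ⟨hσE, hd⟩ x hx
      obtain ⟨t, ht, hxt⟩ := (hEA x).mp (hσE hx)
      rcases hr3 t ht with rfl | rfl | rfl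
      · exact absurd hx (Finset.disjoint_left.mp hd hxt)
      · exact Finset.mem_union_left _ hxt
      · exact Finset.mem_union_right _ hxt
  have f3 : ((E.powerset).filter (fun σ => Disjoint (A z) σ ∧ 𝒱 σ ∧ (b ∈ C (E \ σ) ∧ b ∉ C σ) ∧ (ha (C σ) = 1 ∧ hb (C (E \ σ)) = 0) ∧ (kb (C (E \ σ)) = 1
        ∧ ka (C σ) = 0))).card + ((E.powerset).filter (fun σ => Disjoint (A z) σ ∧ 𝒱 σ ∧ (b ∈ C (E \ σ) ∧ b ∉ C σ) ∧ (ka (C σ) = 1 ∧ kb (C (E \ σ)) = 0)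
        ∧ (hb (C (E \ σ)) = 1 ∧ ha (C σ) = 0))).card ≤
      (((A p ∪ A q).powerset).filter (fun ξ => 𝒱 (ξ ∪ E \ (A p ∪ A q)) ∧ (b ∈ C (ξ ∪ E \ (A p ∪ A q)) ∧ b ∉ C (E \ (ξ ∪ E \ (A p ∪ A q)))) ∧
      ((ha (C (ξ ∪ E \ (A p ∪ A q))) = 1 ∧ kb (C (ξ ∪ E \ (A p ∪ A q))) = 1 ∧ hb (C (E \ (ξ ∪ E \ (A p ∪ A q)))) = 0 ∧ ka (C (E \ (ξ ∪ E \ (A p ∪ A q)))) = 0) ∨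
        (ka (C (ξ ∪ E \ (A p ∪ A q))) = 1 ∧ hb (C (ξ ∪ E \ (A p ∪ A q))) = 1 ∧ kb (C (E \ (ξ ∪ E \ (A p ∪ A q)))) = 0
              ∧ ha (C (E \ (ξ ∪ E \ (A p ∪ A q)))) = 0)))).card + ((E.powerset).filter (fun σ => Disjoint (A z) σ ∧ 𝒱 σ ∧ (b ∈ C (E \ σ) ∧ b ∉ C σ)
              ∧ (ha (C σ) = 1 ∧ ka (C σ) = 1 ∧ hb (C (E \ σ)) = 0 ∧ kb (C (E \ σ)) = 0))).card := by
    convert hBI using 3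
    all_goals (ext σ; simp only [Finset.mem_filter, Finset.mem_powerset, hPQ, hC]; tauto)
  -- the lifts `ξ ∪ A z` are `z`-full targets
  have hO : E \ (A p ∪ A q) = A z := by
    ext x; simp only [Finset.mem_sdiff, Finset.mem_union]; constructor
    · rintro ⟨hxE, hn⟩
      obtain ⟨t, ht, hxt⟩ := (hEA x).mp hxE
      rcases hr3 t ht with rfl | rfl | rfl
      · exact hxt
      · exact absurd (Or.inl hxt) hn
      · exact absurd (Or.inr hxt) hn
    · intro hx
      exact ⟨hAE z hz hx, fun h => h.elim (fun h => Finset.disjoint_left.mp (hAdisj z p hz hp hzp) hx h)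
        fun h => Finset.disjoint_left.mp (hAdisj z q hz hq hzq) hx h⟩
  have f4 : (((A p ∪ A q).powerset).filter (fun ξ => 𝒱 (ξ ∪ E \ (A p ∪ A q)) ∧ (b ∈ C (ξ ∪ E \ (A p ∪ A q)) ∧ b ∉ C (E \ (ξ ∪ E \ (A p ∪ A q)))) ∧
      ((ha (C (ξ ∪ E \ (A p ∪ A q))) = 1 ∧ kb (C (ξ ∪ E \ (A p ∪ A q))) = 1 ∧ hb (C (E \ (ξ ∪ E \ (A p ∪ A q)))) = 0 ∧ ka (C (E \ (ξ ∪ E \ (A p ∪ A q)))) = 0) ∨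
        (ka (C (ξ ∪ E \ (A p ∪ A q))) = 1 ∧ hb (C (ξ ∪ E \ (A p ∪ A q))) = 1 ∧ kb (C (E \ (ξ ∪ E \ (A p ∪ A q)))) = 0
              ∧ ha (C (E \ (ξ ∪ E \ (A p ∪ A q)))) = 0)))).card ≤ ((E.powerset).filter (fun lam => A z ⊆ lam ∧ 𝒱 lam ∧ (b ∈ C lam ∧ b ∉ C (E \ lam)) ∧
      ((ha (C lam) = 1 ∧ kb (C lam) = 1 ∧ hb (C (E \ lam)) = 0 ∧ ka (C (E \ lam)) = 0) ∨
        (ka (C lam) = 1 ∧ hb (C lam) = 1 ∧ kb (C (E \ lam)) = 0 ∧ ha (C (E \ lam)) = 0)))).card := by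
    refine Finset.card_le_card_of_injOn (fun ξ => ξ ∪ E \ (A p ∪ A q)) (fun ξ hξ => ?_) ?_
    · rw [Finset.mem_coe, Finset.mem_filter, Finset.mem_powerset] at hξ
      rw [Finset.mem_coe, Finset.mem_filter, Finset.mem_powerset]
      refine ⟨Finset.union_subset ((hPQ ξ).mp hξ.1).1 Finset.sdiff_subset, ?_, hξ.2⟩
      rw [hO]; exact Finset.subset_union_right
    · intro ξ hξ ξ' hξ' heq
      rw [Finset.mem_coe, Finset.mem_filter, Finset.mem_powerset] at hξ hξ'
      have d1 : Disjoint ξ (E \ (A p ∪ A q)) := by rw [hO]; exact ((hPQ ξ).mp hξ.1).2.symm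
      have d2 : Disjoint ξ' (E \ (A p ∪ A q)) := by rw [hO]; exact ((hPQ ξ').mp hξ'.1).2.symm
      have h1 : (ξ ∪ E \ (A p ∪ A q)) \ (E \ (A p ∪ A q)) = ξ := by
        rw [Finset.union_sdiff_right, Finset.sdiff_eq_self_of_disjoint d1]
      have h2 : (ξ' ∪ E \ (A p ∪ A q)) \ (E \ (A p ∪ A q)) = ξ' := by
        rw [Finset.union_sdiff_right, Finset.sdiff_eq_self_of_disjoint d2]
      have := congrArg (fun s => s \ (E \ (A p ∪ A q))) heq
      simp only [h1, h2] at this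
      exact this
  -- ## (3) the sources starting red on z: class by class
  have nofull : ∀ σ : Finset ι, σ ⊆ E → b ∉ C σ → ∀ t, t < r → ∃ j, 1 ≤ j ∧ j ≤ L t ∧ e t j ∉ σ := by
    intro σ hσ hb' t ht; by_contra hno; push Not at hno
    exact hb' ((full_iff σ hσ).mpr ⟨t, ht, fun x hx => by
      obtain ⟨j, hj1, hjL, rfl⟩ := (hA t ht x).mp hx
      exact hno j hj1 hjL⟩)
  have cover : ∀ σ : Finset ι, σ ⊆ E → e z 1 ∈ σ → b ∉ C σ →
      ∃ a ∈ Finset.Icc 1 (L z - 1), (∀ j, 1 ≤ j → j ≤ a → e z j ∈ σ) ∧ e z (a + 1) ∉ σ := by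
    intro σ hσ h1 hb'
    have hex : ∃ j, 1 ≤ j ∧ j ≤ L z ∧ e z j ∉ σ := nofull σ hσ hb' z hz
    obtain ⟨hj₀1, hj₀ℓ, hj₀σ⟩ := Nat.find_spec hex
    have hmin : ∀ j, j < Nat.find hex → 1 ≤ j → j ≤ L z → e z j ∈ σ := by
      intro j hj hj1 hjℓ
      by_contra hn
      exact Nat.find_min hex hj ⟨hj1, hjℓ, hn⟩
    have hj₀2 : 2 ≤ Nat.find hex := by
      by_contra h
      have h1' : Nat.find hex = 1 := by omega
      rw [h1'] at hj₀σ; exact hj₀σ h1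
    refine ⟨Nat.find hex - 1, Finset.mem_Icc.mpr ⟨by omega, by omega⟩, fun j hj1 hja => hmin j (by omega) hj1 (by omega), ?_⟩
    have hj : Nat.find hex - 1 + 1 = Nat.find hex := by omega
    rw [hj]; exact hj₀σ
  have cov₁ : ((E.powerset).filter (fun σ => e z 1 ∈ σ ∧ 𝒱 σ ∧ (b ∈ C (E \ σ) ∧ b ∉ C σ) ∧ (ha (C σ) = 1 ∧ hb (C (E \ σ)) = 0) ∧ (kb (C (E \ σ)) = 1 ∧ ka (C σ) = 0))) ⊆
      (Finset.Icc 1 (L z - 1)).biUnion (fun a => ((E.powerset).filter (fun σ => ((∀ j, 1 ≤ j → j ≤ a → e z j ∈ σ) ∧ e z (a + 1) ∉ σ) ∧ 𝒱 σ ∧ (b ∈ C (E \ σ)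
            ∧ b ∉ C σ) ∧ (ha (C σ) = 1 ∧ hb (C (E \ σ)) = 0) ∧ (kb (C (E \ σ)) = 1 ∧ ka (C σ) = 0)))) := by
    intro σ hσ
    rw [Finset.mem_filter, Finset.mem_powerset] at hσ
    obtain ⟨a, ha', hcla⟩ := cover σ hσ.1 hσ.2.1 hσ.2.2.2.1.2
    exact Finset.mem_biUnion.mpr ⟨a, ha', Finset.mem_filter.mpr ⟨Finset.mem_powerset.mpr hσ.1, hcla, hσ.2.2⟩⟩
  have cov₂ : ((E.powerset).filter (fun σ => e z 1 ∈ σ ∧ 𝒱 σ ∧ (b ∈ C (E \ σ) ∧ b ∉ C σ) ∧ (ka (C σ) = 1 ∧ kb (C (E \ σ)) = 0) ∧ (hb (C (E \ σ)) = 1 ∧ ha (C σ) = 0))) ⊆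
      (Finset.Icc 1 (L z - 1)).biUnion (fun a => ((E.powerset).filter (fun σ => ((∀ j, 1 ≤ j → j ≤ a → e z j ∈ σ) ∧ e z (a + 1) ∉ σ) ∧ 𝒱 σ ∧ (b ∈ C (E \ σ)
            ∧ b ∉ C σ) ∧ (ka (C σ) = 1 ∧ kb (C (E \ σ)) = 0) ∧ (hb (C (E \ σ)) = 1 ∧ ha (C σ) = 0)))) := by
    intro σ hσ
    rw [Finset.mem_filter, Finset.mem_powerset] at hσ
    obtain ⟨a, ha', hcla⟩ := cover σ hσ.1 hσ.2.1 hσ.2.2.2.1.2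
    exact Finset.mem_biUnion.mpr ⟨a, ha', Finset.mem_filter.mpr ⟨Finset.mem_powerset.mpr hσ.1, hcla, hσ.2.2⟩⟩
  have f5 : ((E.powerset).filter (fun σ => e z 1 ∈ σ ∧ 𝒱 σ ∧ (b ∈ C (E \ σ) ∧ b ∉ C σ) ∧ (ha (C σ) = 1 ∧ hb (C (E \ σ)) = 0) ∧ (kb (C (E \ σ)) = 1
        ∧ ka (C σ) = 0))).card ≤ ∑ a ∈ Finset.Icc 1 (L z - 1), ((E.powerset).filter (fun σ => ((∀ j, 1 ≤ j → j ≤ a → e z j ∈ σ) ∧ e z (a + 1) ∉ σ) ∧ 𝒱 σ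
        ∧ (b ∈ C (E \ σ) ∧ b ∉ C σ) ∧ (ha (C σ) = 1 ∧ hb (C (E \ σ)) = 0) ∧ (kb (C (E \ σ)) = 1 ∧ ka (C σ) = 0))).card :=
    le_trans (Finset.card_le_card cov₁) Finset.card_biUnion_le
  have f6 : ((E.powerset).filter (fun σ => e z 1 ∈ σ ∧ 𝒱 σ ∧ (b ∈ C (E \ σ) ∧ b ∉ C σ) ∧ (ka (C σ) = 1 ∧ kb (C (E \ σ)) = 0) ∧ (hb (C (E \ σ)) = 1
        ∧ ha (C σ) = 0))).card ≤ ∑ a ∈ Finset.Icc 1 (L z - 1), ((E.powerset).filter (fun σ => ((∀ j, 1 ≤ j → j ≤ a → e z j ∈ σ) ∧ e z (a + 1) ∉ σ) ∧ 𝒱 σ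
        ∧ (b ∈ C (E \ σ) ∧ b ∉ C σ) ∧ (ka (C σ) = 1 ∧ kb (C (E \ σ)) = 0) ∧ (hb (C (E \ σ)) = 1 ∧ ha (C σ) = 0))).card :=
    le_trans (Finset.card_le_card cov₂) Finset.card_biUnion_le
  have percls : ∀ a ∈ Finset.Icc 1 (L z - 1), ((E.powerset).filter (fun σ => ((∀ j, 1 ≤ j → j ≤ a → e z j ∈ σ) ∧ e z (a + 1) ∉ σ) ∧ 𝒱 σ ∧ (b ∈ C (E \ σ)
        ∧ b ∉ C σ) ∧ (ha (C σ) = 1 ∧ hb (C (E \ σ)) = 0) ∧ (kb (C (E \ σ)) = 1 ∧ ka (C σ) = 0))).card + ((E.powerset).filter (fun σ => ((∀ j, 1 ≤ j → j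
        ≤ a → e z j ∈ σ) ∧ e z (a + 1) ∉ σ) ∧ 𝒱 σ ∧ (b ∈ C (E \ σ) ∧ b ∉ C σ) ∧ (ka (C σ) = 1 ∧ kb (C (E \ σ)) = 0) ∧ (hb (C (E \ σ)) = 1 ∧ ha (C σ) = 0))).card
        ≤ ((E.powerset).filter (fun lam => ((∀ j, 1 ≤ j → j ≤ a → e z j ∈ lam) ∧ e z (a + 1) ∉ lam) ∧ 𝒱 lam ∧ (b ∈ C lam ∧ b ∉ C (E \ lam)) ∧
      ((ha (C lam) = 1 ∧ kb (C lam) = 1 ∧ hb (C (E \ lam)) = 0 ∧ ka (C (E \ lam)) = 0) ∨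
        (ka (C lam) = 1 ∧ hb (C lam) = 1 ∧ kb (C (E \ lam)) = 0 ∧ ha (C (E \ lam)) = 0)))).card := by
    intro a ha'
    rw [Finset.mem_Icc] at ha'
    have k := bundle_class_count ends r L hL w e u b hw0 hwL harc hwinj hcross A hA hAdisj E hEA z p q hz hp hq hzp hzq hpq hr3 a ha'.1 (by omega)
      𝒱 hV ha hb ka kb mha mhb mka mkb ha01 hb01 ka01 kb01
    convert k using 3
  have f7 : ∑ a ∈ Finset.Icc 1 (L z - 1), ((E.powerset).filter (fun σ => ((∀ j, 1 ≤ j → j ≤ a → e z j ∈ σ) ∧ e z (a + 1) ∉ σ) ∧ 𝒱 σ ∧ (b ∈ C (E \ σ) ∧ b ∉ C σ)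
        ∧ (ha (C σ) = 1 ∧ hb (C (E \ σ)) = 0) ∧ (kb (C (E \ σ)) = 1 ∧ ka (C σ) = 0))).card + ∑ a ∈ Finset.Icc 1 (L z - 1), ((E.powerset).filter (fun σ => ((∀ j, 1
        ≤ j → j ≤ a → e z j ∈ σ) ∧ e z (a + 1) ∉ σ) ∧ 𝒱 σ ∧ (b ∈ C (E \ σ) ∧ b ∉ C σ) ∧ (ka (C σ) = 1 ∧ kb (C (E \ σ)) = 0) ∧ (hb (C (E \ σ)) = 1 ∧ ha (C σ) = 0))).card ≤
      ∑ a ∈ Finset.Icc 1 (L z - 1), ((E.powerset).filter (fun lam => ((∀ j, 1 ≤ j → j ≤ a → e z j ∈ lam) ∧ e z (a + 1) ∉ lam) ∧ 𝒱 lam ∧ (b ∈ C lam ∧ b ∉ C (E \ lam)) ∧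
      ((ha (C lam) = 1 ∧ kb (C lam) = 1 ∧ hb (C (E \ lam)) = 0 ∧ ka (C (E \ lam)) = 0) ∨
        (ka (C lam) = 1 ∧ hb (C lam) = 1 ∧ kb (C (E \ lam)) = 0 ∧ ha (C (E \ lam)) = 0)))).card := by
    rw [← Finset.sum_add_distrib]; exact Finset.sum_le_sum percls
  have clsdisj : ∀ a ∈ Finset.Icc 1 (L z - 1), ∀ a' ∈ Finset.Icc 1 (L z - 1), a ≠ a' → Disjoint ((E.powerset).filter (fun lam => ((∀ j, 1 ≤ j → j
        ≤ a → e z j ∈ lam) ∧ e z (a + 1) ∉ lam) ∧ 𝒱 lam ∧ (b ∈ C lam ∧ b ∉ C (E \ lam)) ∧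
      ((ha (C lam) = 1 ∧ kb (C lam) = 1 ∧ hb (C (E \ lam)) = 0 ∧ ka (C (E \ lam)) = 0) ∨
        (ka (C lam) = 1 ∧ hb (C lam) = 1 ∧ kb (C (E \ lam)) = 0 ∧ ha (C (E \ lam)) = 0))))
      ((E.powerset).filter (fun lam => ((∀ j, 1 ≤ j → j ≤ a' → e z j ∈ lam) ∧ e z (a' + 1) ∉ lam) ∧ 𝒱 lam ∧ (b ∈ C lam ∧ b ∉ C (E \ lam)) ∧
      ((ha (C lam) = 1 ∧ kb (C lam) = 1 ∧ hb (C (E \ lam)) = 0 ∧ ka (C (E \ lam)) = 0) ∨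
        (ka (C lam) = 1 ∧ hb (C lam) = 1 ∧ kb (C (E \ lam)) = 0 ∧ ha (C (E \ lam)) = 0)))) := by
    intro a _ a' _ hne
    rw [Finset.disjoint_filter]
    intro lam _ h1 h2
    rcases Nat.lt_or_gt_of_ne hne with hlt | hlt
    · exact h1.1.2 (h2.1.1 (a + 1) (by omega) (by omega))
    · exact h2.1.2 (h1.1.1 (a' + 1) (by omega) (by omega))
  have clssub : (Finset.Icc 1 (L z - 1)).biUnion (fun a => ((E.powerset).filter (fun lam => ((∀ j, 1 ≤ j → j ≤ a → e z j ∈ lam) ∧ e z (a + 1) ∉ lam) ∧ 𝒱 lam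
        ∧ (b ∈ C lam ∧ b ∉ C (E \ lam)) ∧
      ((ha (C lam) = 1 ∧ kb (C lam) = 1 ∧ hb (C (E \ lam)) = 0 ∧ ka (C (E \ lam)) = 0) ∨
        (ka (C lam) = 1 ∧ hb (C lam) = 1 ∧ kb (C (E \ lam)) = 0 ∧ ha (C (E \ lam)) = 0))))) ⊆ ((E.powerset).filter (fun lam => (e z 1 ∈ lam ∧ ¬ A z ⊆ lam) ∧ 𝒱 lam
              ∧ (b ∈ C lam ∧ b ∉ C (E \ lam)) ∧
      ((ha (C lam) = 1 ∧ kb (C lam) = 1 ∧ hb (C (E \ lam)) = 0 ∧ ka (C (E \ lam)) = 0) ∨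
        (ka (C lam) = 1 ∧ hb (C lam) = 1 ∧ kb (C (E \ lam)) = 0 ∧ ha (C (E \ lam)) = 0)))) := by
    intro lam hlam
    obtain ⟨a, ha', hmem⟩ := Finset.mem_biUnion.mp hlam
    rw [Finset.mem_Icc] at ha'
    rw [Finset.mem_filter] at hmem
    rw [Finset.mem_filter]
    exact ⟨hmem.1, ⟨hmem.2.1.1 1 (le_refl 1) ha'.1, fun hsub => hmem.2.1.2 (hsub (heA z hz (a + 1) (by omega) (by omega)))⟩, hmem.2.2⟩
  have f8 : ∑ a ∈ Finset.Icc 1 (L z - 1), ((E.powerset).filter (fun lam => ((∀ j, 1 ≤ j → j ≤ a → e z j ∈ lam) ∧ e z (a + 1) ∉ lam) ∧ 𝒱 lam ∧ (b ∈ C lam ∧ b ∉ C (E \ lam)) ∧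
      ((ha (C lam) = 1 ∧ kb (C lam) = 1 ∧ hb (C (E \ lam)) = 0 ∧ ka (C (E \ lam)) = 0) ∨
        (ka (C lam) = 1 ∧ hb (C lam) = 1 ∧ kb (C (E \ lam)) = 0 ∧ ha (C (E \ lam)) = 0)))).card ≤ ((E.powerset).filter (fun lam => (e z 1 ∈ lam ∧ ¬ A z ⊆ lam)
              ∧ 𝒱 lam ∧ (b ∈ C lam ∧ b ∉ C (E \ lam)) ∧
      ((ha (C lam) = 1 ∧ kb (C lam) = 1 ∧ hb (C (E \ lam)) = 0 ∧ ka (C (E \ lam)) = 0) ∨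
        (ka (C lam) = 1 ∧ hb (C lam) = 1 ∧ kb (C (E \ lam)) = 0 ∧ ha (C (E \ lam)) = 0)))).card := by
    rw [← Finset.card_biUnion clsdisj]
    exact Finset.card_le_card clssub
  -- ## (4) the two target families are disjoint parts of the z-red-starting targets
  have f9 : ((E.powerset).filter (fun lam => A z ⊆ lam ∧ 𝒱 lam ∧ (b ∈ C lam ∧ b ∉ C (E \ lam)) ∧
      ((ha (C lam) = 1 ∧ kb (C lam) = 1 ∧ hb (C (E \ lam)) = 0 ∧ ka (C (E \ lam)) = 0) ∨
        (ka (C lam) = 1 ∧ hb (C lam) = 1 ∧ kb (C (E \ lam)) = 0 ∧ ha (C (E \ lam)) = 0)))).card + ((E.powerset).filter (fun lam => (e z 1 ∈ lam ∧ ¬ A z ⊆ lam)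
              ∧ 𝒱 lam ∧ (b ∈ C lam ∧ b ∉ C (E \ lam)) ∧
      ((ha (C lam) = 1 ∧ kb (C lam) = 1 ∧ hb (C (E \ lam)) = 0 ∧ ka (C (E \ lam)) = 0) ∨
        (ka (C lam) = 1 ∧ hb (C lam) = 1 ∧ kb (C (E \ lam)) = 0 ∧ ha (C (E \ lam)) = 0)))).card ≤ ((E.powerset).filter (fun lam => e z 1 ∈ lam ∧ 𝒱 lam
              ∧ (b ∈ C lam ∧ b ∉ C (E \ lam)) ∧
      ((ha (C lam) = 1 ∧ kb (C lam) = 1 ∧ hb (C (E \ lam)) = 0 ∧ ka (C (E \ lam)) = 0) ∨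
        (ka (C lam) = 1 ∧ hb (C lam) = 1 ∧ kb (C (E \ lam)) = 0 ∧ ha (C (E \ lam)) = 0)))).card := by
    rw [← Finset.card_union_of_disjoint]
    · apply Finset.card_le_card
      intro lam hlam
      rw [Finset.mem_union, Finset.mem_filter, Finset.mem_filter] at hlam
      rw [Finset.mem_filter]
      rcases hlam with h | h
      · exact ⟨h.1, h.2.1 hz1, h.2.2⟩
      · exact ⟨h.1, h.2.1.1, h.2.2⟩
    · rw [Finset.disjoint_filter]
      intro lam _ h1 h2
      exact h2.1.2 h1.1
  have fin : ((E.powerset).filter (fun σ => (e z 1 ∈ σ ∨ Disjoint (A z) σ) ∧ 𝒱 σ ∧ (b ∈ C (E \ σ) ∧ b ∉ C σ) ∧ (ha (C σ) = 1 ∧ hb (C (E \ σ)) = 0)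
        ∧ (kb (C (E \ σ)) = 1 ∧ ka (C σ) = 0))).card + ((E.powerset).filter (fun σ => (e z 1 ∈ σ ∨ Disjoint (A z) σ) ∧ 𝒱 σ ∧ (b ∈ C (E \ σ) ∧ b ∉ C σ)
        ∧ (ka (C σ) = 1 ∧ kb (C (E \ σ)) = 0) ∧ (hb (C (E \ σ)) = 1 ∧ ha (C σ) = 0))).card ≤ ((E.powerset).filter (fun lam => e z 1 ∈ lam ∧ 𝒱 lam ∧ (b ∈ C lam
        ∧ b ∉ C (E \ lam)) ∧
      ((ha (C lam) = 1 ∧ kb (C lam) = 1 ∧ hb (C (E \ lam)) = 0 ∧ ka (C (E \ lam)) = 0) ∨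
        (ka (C lam) = 1 ∧ hb (C lam) = 1 ∧ kb (C (E \ lam)) = 0 ∧ ha (C (E \ lam)) = 0)))).card + ((E.powerset).filter (fun σ => Disjoint (A z) σ ∧ 𝒱 σ
              ∧ (b ∈ C (E \ σ) ∧ b ∉ C σ) ∧ (ha (C σ) = 1 ∧ ka (C σ) = 1 ∧ hb (C (E \ σ)) = 0 ∧ kb (C (E \ σ)) = 0))).card := by
    omega
  convert fin using 3

open Classical in
/-- **THEOREM CT (clean-thread IET, three threads, all monotone real levels, every up-set).**  For `0 ≤ hᵃ, hᵇ ≤ h`, `0 ≤ kᵃ, kᵇ ≤ k` monotone and every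
up-closed `𝒱`, the IET functional whose DEMAND is restricted to the colourings not blue-starting on the thread `z` is nonnegative:
`0 ≤ Σ_{ω ∈ 𝒱, b ∈ X∖Y} h(X) k(X) + Σ_{ω ∈ 𝒱, (e z 1 red ∨ z blue), b ∈ Y∖X} (hᵃX − hᵇY)(kᵃX − kᵇY)`.  In particular CONJECTURE IET holds for every
`𝒱` with a clean thread.  Memo gen 59 §1.  [cite: KozmaNitzan2024, Questions 8–9 (§5.5 p. 36) (context); Harris 1960] -/
theorem iet_clean_thread_bundle (ends : ι → Sym2 V) (r : ℕ) (L : ℕ → ℕ) (hL : ∀ t, t < r → 1 ≤ L t)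
    (w : ℕ → ℕ → V) (e : ℕ → ℕ → ι) (u b : V)
    (hw0 : ∀ t, t < r → w t 0 = u) (hwL : ∀ t, t < r → w t (L t) = b)
    (harc : ∀ t, t < r → ∀ j, 1 ≤ j → j ≤ L t → ends (e t j) = s(w t (j - 1), w t j))
    (hwinj : ∀ t, t < r → ∀ i j, i ≤ L t → j ≤ L t → w t i = w t j → i = j)
    (hcross : ∀ t t', t < r → t' < r → t ≠ t' → ∀ i j, i ≤ L t → j ≤ L t' → w t i = w t' j → (i = 0 ∧ j = 0) ∨ (i = L t ∧ j = L t'))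
    (A : ℕ → Finset ι) (hA : ∀ t, t < r → ∀ i, i ∈ A t ↔ ∃ j, 1 ≤ j ∧ j ≤ L t ∧ e t j = i)
    (hAdisj : ∀ t t', t < r → t' < r → t ≠ t' → Disjoint (A t) (A t'))
    (E : Finset ι) (hEA : ∀ i, i ∈ E ↔ ∃ t, t < r ∧ i ∈ A t)
    (z p q : ℕ) (hz : z < r) (hp : p < r) (hq : q < r) (hzp : z ≠ p) (hzq : z ≠ q) (hpq : p ≠ q)
    (hr3 : ∀ t, t < r → t = z ∨ t = p ∨ t = q)
    (𝒱 : Finset ι → Prop) (hV : ∀ ⦃s t : Finset ι⦄, s ⊆ t → 𝒱 s → 𝒱 t)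
    (h k ha hb ka kb : Set V → ℝ) (mh : Monotone h) (mk : Monotone k)
    (mha : Monotone ha) (mhb : Monotone hb) (mka : Monotone ka) (mkb : Monotone kb)
    (ha0 : ∀ S, 0 ≤ ha S) (hah : ∀ S, ha S ≤ h S) (hb0 : ∀ S, 0 ≤ hb S) (hbh : ∀ S, hb S ≤ h S)
    (ka0 : ∀ S, 0 ≤ ka S) (kak : ∀ S, ka S ≤ k S) (kb0 : ∀ S, 0 ≤ kb S) (kbk : ∀ S, kb S ≤ k S) :
    0 ≤ (∑ ω ∈ E.powerset, if 𝒱 ω ∧ (b ∈ openCluster (ends '' (↑ω : Set ι)) u ∧ b ∉ openCluster (ends '' (↑(E \ ω) : Set ι)) u) then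
        h (openCluster (ends '' (↑ω : Set ι)) u) * k (openCluster (ends '' (↑ω : Set ι)) u) else 0)
      + ∑ ω ∈ E.powerset, if (𝒱 ω ∧ (e z 1 ∈ ω ∨ Disjoint (A z) ω)) ∧ (b ∈ openCluster (ends '' (↑(E \ ω) : Set ι)) u ∧
          b ∉ openCluster (ends '' (↑ω : Set ι)) u) then
        (ha (openCluster (ends '' (↑ω : Set ι)) u) - hb (openCluster (ends '' (↑(E \ ω) : Set ι)) u)) *
          (ka (openCluster (ends '' (↑ω : Set ι)) u) - kb (openCluster (ends '' (↑(E \ ω) : Set ι)) u)) else 0 := by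
  set C : Finset ι → Set V := fun ω => openCluster (ends '' (↑ω : Set ι)) u with hC
  refine iet_of_indicator_levels E (fun ω => 𝒱 ω ∧ (b ∈ C ω ∧ b ∉ C (E \ ω)))
    (fun ω => (𝒱 ω ∧ (e z 1 ∈ ω ∨ Disjoint (A z) ω)) ∧ (b ∈ C (E \ ω) ∧ b ∉ C ω)) C (fun ω => C (E \ ω)) ?_
    h k ha hb ka kb mh mk mha mhb mka mkb ha0 hah hb0 hbh ka0 kak kb0 kbk
  intro h k ha hb ka kb mh mk mha mhb mka mkb h01 k01 ha01 hb01 ka01 kb01 hah hbh kak kbk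
  have cnt := iet01_ge_count E (fun ω => 𝒱 ω ∧ (b ∈ C ω ∧ b ∉ C (E \ ω)))
    (fun ω => (𝒱 ω ∧ (e z 1 ∈ ω ∨ Disjoint (A z) ω)) ∧ (b ∈ C (E \ ω) ∧ b ∉ C ω)) C (fun ω => C (E \ ω)) h k ha hb ka kb h01 k01 ha01 hb01 ka01 kb01
  have ct := bundle_clean_thread_count ends r L hL w e u b hw0 hwL harc hwinj hcross A hA hAdisj E hEA z p q hz hp hq hzp hzq hpq hr3 𝒱 hV
    ha hb ka kb mha mhb mka mkb ha01 hb01 ka01 kb01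
  have up1 : ∀ (f g : Set V → ℝ), (∀ S, g S = 0 ∨ g S = 1) → (∀ S, f S ≤ g S) → ∀ S, f S = 1 → g S = 1 := by
    intro f g g01 hfg S e1; rcases g01 S with h0 | h0
    · have := hfg S; rw [e1, h0] at this; linarith
    · exact h0
  have hz1 : e z 1 ∈ A z := (hA z hz _).mpr ⟨1, le_refl 1, hL z hz, rfl⟩
  -- demand-side sums are the clean source counts
  have d1 : (∑ ω ∈ E.powerset, if ((𝒱 ω ∧ (e z 1 ∈ ω ∨ Disjoint (A z) ω)) ∧ (b ∈ C (E \ ω) ∧ b ∉ C ω)) ∧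
        ha (C ω) = 1 ∧ kb (C (E \ ω)) = 1 ∧ hb (C (E \ ω)) = 0 ∧ ka (C ω) = 0 then (1 : ℝ) else 0) ≤
      (((E.powerset).filter (fun σ => (e z 1 ∈ σ ∨ Disjoint (A z) σ) ∧ 𝒱 σ ∧ (b ∈ C (E \ σ) ∧ b ∉ C σ) ∧
        (ha (C σ) = 1 ∧ hb (C (E \ σ)) = 0) ∧ (kb (C (E \ σ)) = 1 ∧ ka (C σ) = 0))).card : ℝ) := by
    rw [Finset.natCast_card_filter]
    refine Finset.sum_le_sum fun ω _ => ?_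
    by_cases hP : ((𝒱 ω ∧ (e z 1 ∈ ω ∨ Disjoint (A z) ω)) ∧ (b ∈ C (E \ ω) ∧ b ∉ C ω)) ∧
        ha (C ω) = 1 ∧ kb (C (E \ ω)) = 1 ∧ hb (C (E \ ω)) = 0 ∧ ka (C ω) = 0
    · rw [if_pos hP, if_pos ⟨hP.1.1.2, hP.1.1.1, hP.1.2, ⟨hP.2.1, hP.2.2.2.1⟩, ⟨hP.2.2.1, hP.2.2.2.2⟩⟩]
    · rw [if_neg hP]; split_ifs <;> norm_num
  have d2 : (∑ ω ∈ E.powerset, if ((𝒱 ω ∧ (e z 1 ∈ ω ∨ Disjoint (A z) ω)) ∧ (b ∈ C (E \ ω) ∧ b ∉ C ω)) ∧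
        hb (C (E \ ω)) = 1 ∧ ka (C ω) = 1 ∧ ha (C ω) = 0 ∧ kb (C (E \ ω)) = 0 then (1 : ℝ) else 0) ≤
      (((E.powerset).filter (fun σ => (e z 1 ∈ σ ∨ Disjoint (A z) σ) ∧ 𝒱 σ ∧ (b ∈ C (E \ σ) ∧ b ∉ C σ) ∧
        (ka (C σ) = 1 ∧ kb (C (E \ σ)) = 0) ∧ (hb (C (E \ σ)) = 1 ∧ ha (C σ) = 0))).card : ℝ) := by
    rw [Finset.natCast_card_filter]
    refine Finset.sum_le_sum fun ω _ => ?_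
    by_cases hP : ((𝒱 ω ∧ (e z 1 ∈ ω ∨ Disjoint (A z) ω)) ∧ (b ∈ C (E \ ω) ∧ b ∉ C ω)) ∧
        hb (C (E \ ω)) = 1 ∧ ka (C ω) = 1 ∧ ha (C ω) = 0 ∧ kb (C (E \ ω)) = 0
    · rw [if_pos hP, if_pos ⟨hP.1.1.2, hP.1.1.1, hP.1.2, ⟨hP.2.2.1, hP.2.2.2.2⟩, ⟨hP.2.1, hP.2.2.2.1⟩⟩]
    · rw [if_neg hP]; split_ifs <;> norm_num
  -- the P₁ points with `z` blue are among the counted P₁ points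
  have d3 : (((E.powerset).filter (fun σ => Disjoint (A z) σ ∧ 𝒱 σ ∧ (b ∈ C (E \ σ) ∧ b ∉ C σ) ∧
        (ha (C σ) = 1 ∧ ka (C σ) = 1 ∧ hb (C (E \ σ)) = 0 ∧ kb (C (E \ σ)) = 0))).card : ℝ) ≤
      ∑ ω ∈ E.powerset, if ((𝒱 ω ∧ (e z 1 ∈ ω ∨ Disjoint (A z) ω)) ∧ (b ∈ C (E \ ω) ∧ b ∉ C ω)) ∧
        ha (C ω) = 1 ∧ ka (C ω) = 1 ∧ hb (C (E \ ω)) = 0 ∧ kb (C (E \ ω)) = 0 then (1 : ℝ) else 0 := by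
    rw [Finset.natCast_card_filter]
    refine Finset.sum_le_sum fun ω _ => ?_
    by_cases hP : Disjoint (A z) ω ∧ 𝒱 ω ∧ (b ∈ C (E \ ω) ∧ b ∉ C ω) ∧ (ha (C ω) = 1 ∧ ka (C ω) = 1 ∧ hb (C (E \ ω)) = 0 ∧ kb (C (E \ ω)) = 0)
    · rw [if_pos hP, if_pos ⟨⟨⟨hP.2.1, Or.inr hP.1⟩, hP.2.2.1⟩, hP.2.2.2⟩]
    · rw [if_neg hP]; split_ifs <;> norm_num
  -- supply side: L₁ ∪ L₂ ⊆ S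
  have s1 : (((E.powerset).filter (fun lam => e z 1 ∈ lam ∧ 𝒱 lam ∧ (b ∈ C lam ∧ b ∉ C (E \ lam)) ∧
      ((ha (C lam) = 1 ∧ kb (C lam) = 1 ∧ hb (C (E \ lam)) = 0 ∧ ka (C (E \ lam)) = 0) ∨
        (ka (C lam) = 1 ∧ hb (C lam) = 1 ∧ kb (C (E \ lam)) = 0 ∧ ha (C (E \ lam)) = 0)))).card : ℝ) ≤
      ∑ ω ∈ E.powerset, if (𝒱 ω ∧ (b ∈ C ω ∧ b ∉ C (E \ ω))) ∧ h (C ω) = 1 ∧ k (C ω) = 1 then (1 : ℝ) else 0 := by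
    rw [Finset.natCast_card_filter]
    refine Finset.sum_le_sum fun ω _ => ?_
    by_cases hP : e z 1 ∈ ω ∧ 𝒱 ω ∧ (b ∈ C ω ∧ b ∉ C (E \ ω)) ∧
        ((ha (C ω) = 1 ∧ kb (C ω) = 1 ∧ hb (C (E \ ω)) = 0 ∧ ka (C (E \ ω)) = 0) ∨
          (ka (C ω) = 1 ∧ hb (C ω) = 1 ∧ kb (C (E \ ω)) = 0 ∧ ha (C (E \ ω)) = 0))
    · have hQ : (𝒱 ω ∧ (b ∈ C ω ∧ b ∉ C (E \ ω))) ∧ h (C ω) = 1 ∧ k (C ω) = 1 := by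
        refine ⟨⟨hP.2.1, hP.2.2.1⟩, ?_⟩
        rcases hP.2.2.2 with hL' | hL'
        · exact ⟨up1 ha h h01 hah _ hL'.1, up1 kb k k01 kbk _ hL'.2.1⟩
        · exact ⟨up1 hb h h01 hbh _ hL'.2.1, up1 ka k k01 kak _ hL'.1⟩
      rw [if_pos hP, if_pos hQ]
    · rw [if_neg hP]; split_ifs <;> norm_num
  have ct' : (((E.powerset).filter (fun σ => (e z 1 ∈ σ ∨ Disjoint (A z) σ) ∧ 𝒱 σ ∧ (b ∈ C (E \ σ) ∧ b ∉ C σ) ∧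
        (ha (C σ) = 1 ∧ hb (C (E \ σ)) = 0) ∧ (kb (C (E \ σ)) = 1 ∧ ka (C σ) = 0))).card : ℝ) +
      (((E.powerset).filter (fun σ => (e z 1 ∈ σ ∨ Disjoint (A z) σ) ∧ 𝒱 σ ∧ (b ∈ C (E \ σ) ∧ b ∉ C σ) ∧
        (ka (C σ) = 1 ∧ kb (C (E \ σ)) = 0) ∧ (hb (C (E \ σ)) = 1 ∧ ha (C σ) = 0))).card : ℝ) ≤
      (((E.powerset).filter (fun lam => e z 1 ∈ lam ∧ 𝒱 lam ∧ (b ∈ C lam ∧ b ∉ C (E \ lam)) ∧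
        ((ha (C lam) = 1 ∧ kb (C lam) = 1 ∧ hb (C (E \ lam)) = 0 ∧ ka (C (E \ lam)) = 0) ∨
          (ka (C lam) = 1 ∧ hb (C lam) = 1 ∧ kb (C (E \ lam)) = 0 ∧ ha (C (E \ lam)) = 0)))).card : ℝ) +
      (((E.powerset).filter (fun σ => Disjoint (A z) σ ∧ 𝒱 σ ∧ (b ∈ C (E \ σ) ∧ b ∉ C σ) ∧
        (ha (C σ) = 1 ∧ ka (C σ) = 1 ∧ hb (C (E \ σ)) = 0 ∧ kb (C (E \ σ)) = 0))).card : ℝ) := by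
    have hnat := (Nat.cast_le (α := ℝ)).mpr ct
    rw [Nat.cast_add, Nat.cast_add] at hnat
    convert hnat using 4
  refine le_trans ?_ cnt
  linarith [d1, d2, d3, s1, ct']

end Coefficientwise

end Summit.CriticalPhenomena.PercolationContinuityZ3.Theorems
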